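import Summits.MatrixMultiplication.OmegaCensus.STPPVosperSlackTwoCheckersC

/-!
# ω-census (abelian STPP census): `{(3,3,3),(3,3,4)} ⊄ ℤ₆₁` — slack-2 partition law, CASE C rows, `P`-indices `[0, 40)` (kernel computations)

HONEST FRAMING (pub-omega census; verbatim): lottery ticket; floor = certified bounds/negative ranges.
Census STRUCTURE (seat pub-omega-stpp-2 gen 27, 2026-08-28), family (b2).  Rows for the kill of the leaf `{(3,3,3),(3,3,4)} @ ℤ₆₁` by the slack-2
partition law (stpp-1 lineage: `STPPVosperSlackTwoShapes.lean`, checkers `STPPVosperSlackTwoCheckers.lean` / `…CheckersC.lean`, SPEC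
`no_isSTPP_of_slack_two_rows`): reading `(a, b, c) = (4, 3, 3)` of the block `(3,3,4)`, the other block `(3, 3, 3)`, `L = z = 9`.  Case C:
`caseCDeadQP' 61 3 9 9 3 3 3 Q P = true` for `Q ∈ qShapesC 3` and the `P`-shapes of `pShapesC 61 4` with indices in `[0, 40)` except the heavy index 11 (interval pattern; own file, branch-split), in chunks
`[lo, lo + n)` sized by the python cost mirror (HOME `pub-omega-stpp-2-g27/code/costC.py`, calibrated ≈ 118 s of kernel per 10⁶ mirror steps on two farm
probes) to ≤ 0.45·10⁶ steps ≈ 55 s each; ONE `decide +kernel` per chunk.  Assembly in `STPPVosperSlackTwoRows61CAsm.lean`.  Nothing here is progress on `ω`.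

References: H. Cohn, R. Kleinberg, B. Szegedy, C. Umans, FOCS 2005 (arXiv:math/0511460), Def. 5.1; Y. O. Hamidoune, Ø. J. Rødseth, Acta Arith. 92 (2000).
-/

namespace Summit.MatrixMultiplication.OmegaCensus.CubeNB.S2

/-- Case C rows, `P`-shape indices `[31, 38)` (all three `Q`-shapes): the checker certifies death. [folklore] -/
theorem rowsC61_r31_7 : ((((pShapesC 61 4).drop 31).take 7).all fun P => (qShapesC 3).all fun Q => caseCDeadQP' 61 3 9 9 3 3 3 Q P) = true := by
  decide +kernel

/-- Case C rows, `P`-shape indices `[38, 40)` (all three `Q`-shapes): the checker certifies death. [folklore] -/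
theorem rowsC61_r38_2 : ((((pShapesC 61 4).drop 38).take 2).all fun P => (qShapesC 3).all fun Q => caseCDeadQP' 61 3 9 9 3 3 3 Q P) = true := by
  decide +kernel

end Summit.MatrixMultiplication.OmegaCensus.CubeNB.S2
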